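import Summits.CriticalPhenomena.PercolationContinuityZ3.Theorems.Transplant.StatementBoxProdZ2
import Summits.CriticalPhenomena.PercolationContinuityZ3.Theorems.Transplant.BoxProdZ2Defs
import Summits.CriticalPhenomena.PercolationContinuityZ3.Theorems.TransplantQuotientSlabCriterion
import Summits.CriticalPhenomena.PercolationContinuityZ3.Theorems.TransplantHeisenbergZ2SlabCritical
import Summits.CriticalPhenomena.PercolationContinuityZ3.Theorems.TransplantBoxProdZeroOne
import Literature.Probability.RandomPlanarGeometry.PlaneNonIntersectionProofs
import Literature.Probability.Percolation.GrimmettMarstrand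
import HarnessLib

/-!
# Tubes of `X □ ℤ²` are strictly subcritical at `p_c(X □ ℤ²)` — for EVERY connected quasi-transitive `X`
# (`TubeSubcritical X p_c`, the hypothesis of the flagship statement `SamePWitnessBoxProdZ2`, discharged)

Builds on p205010 (kernel theorem, internal audit signed; external expert review pending).  Lane
`prim-bschramm`, BLUEPRINT-I-PHI §6 Target 1, lead's request 2026-08-20T06:33:45Z ("YOUR PIECE, priority 1");
memo `run/shared/lean/prim/bschramm/P3-NILPOTENT.md` §10.

For `G = X □ ℤ²` (`X` connected, locally finite, quasi-transitive, countable vertex type) and the tube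
`BoxProdZ2.tube W ℓ = X × [−ℓ,ℓ]²`: the translation `u ↦ u + N e₀` of the `ℤ²` factor (`N = 2ℓ + 2`) generates a
free action `Γ_N ≅ ℤ` by automorphisms with quasi-transitive quotient (the product automorphisms
`boxProdIso γ (zdShiftIso v)` commute with it and descend, `HeisenbergZ.quotIsoOfEquivariant`); the tube meets each
`Γ_N`-orbit at most once and no edge of `G` joins it to a non-trivial translate; and `p_c(G) ≤ p_c(ℤ²) < 1`
(`criticalProb_boxProdZ2_lt_one`).  So the quotient–slab criterion (p208012,
`QuotientSlab.criticalProb_lt_criticalProb_induce_of_quotient`, i.e. Martineau–Severo Cor. 2.2 +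
restriction coupling) gives

* `criticalProb_lt_criticalProb_tube : p_c(G,(w,0)) < p_c(G[tube ℓ],(w,0))` for all `ℓ, w`;
* `tubeSubcritical_criticalProb : TubeSubcritical X p_c(G)` — in the exact shape requested (the hypotheses
  `IsGraphAmenable X`, `Infinite W` of the flagship are carried but not used).
[cite: MartineauSevero2019, Cor. 2.2] [cite: BenjaminiSchramm1996, Thm. 1]
-/

noncomputable section

namespace Summit.CriticalPhenomena.PercolationContinuityZ3.Theorems.Transplant.BoxProdZ2

open MeasureTheory Literature.Probability.Percolation Literature.Probability.LatticeModels
open Literature.Barriers.CriticalPhenomena (IsQuasiTransitive IsGraphAmenable)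
open Summit.CriticalPhenomena.PercolationContinuityZ3.Theorems.BoxProdZd (prodShift prodShiftIso prodShift_apply)

variable {W : Type}

/-! ## The free action `Γ_N`: `u ↦ u + Nn·e₀` on the `ℤ²` factor -/

/-- `Γ_N ≅ ℤ` (type synonym of `Multiplicative ℤ`; the action lives on `W × Site 2`). [folklore] -/
def PlaneShift (_W : Type) (_N : ℕ) : Type := Multiplicative ℤ

/-- group structure. [folklore] -/
instance (N : ℕ) : Group (PlaneShift W N) := inferInstanceAs (Group (Multiplicative ℤ))
/-- non-trivial. [folklore] -/
instance (N : ℕ) : Nontrivial (PlaneShift W N) := inferInstanceAs (Nontrivial (Multiplicative ℤ))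

/-- exponent. [folklore] -/
def PlaneShift.exp {N : ℕ} (g : PlaneShift W N) : ℤ := Multiplicative.toAdd (show Multiplicative ℤ from g)

/-- `exp 1 = 0`. [folklore] -/
@[simp] theorem PlaneShift.exp_one {N : ℕ} : (1 : PlaneShift W N).exp = 0 := rfl

/-- `exp` is injective. [folklore] -/
theorem PlaneShift.exp_injective {N : ℕ} : Function.Injective (PlaneShift.exp (W := W) (N := N)) :=
  fun _ _ h => Multiplicative.toAdd.injective h

/-- The translation action on `W × Site 2`. [folklore] -/
instance (N : ℕ) : MulAction (PlaneShift W N) (W × Site 2) where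
  smul g x := (x.1, x.2 + Pi.single 0 (N * g.exp))
  one_smul x := by
    show ((x.1, x.2 + Pi.single 0 (N * (Multiplicative.toAdd (1 : Multiplicative ℤ)))) : W × Site 2) = x
    simp
  mul_smul g h x := by
    show ((x.1, x.2 + Pi.single 0 (N * (g * h).exp)) : W × Site 2) =
      (x.1, (x.2 + Pi.single 0 (N * h.exp)) + Pi.single 0 (N * g.exp))
    have : (g * h).exp = g.exp + h.exp := rfl
    rw [this, add_assoc, ← Pi.single_add]
    congr 3; ring

/-- The action, unfolded. [folklore] -/
theorem PlaneShift.smul_def {N : ℕ} (g : PlaneShift W N) (x : W × Site 2) :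
    g • x = (x.1, x.2 + Pi.single 0 (N * g.exp)) := rfl

/-- … as the product automorphism `prodShiftIso`. [folklore] -/
theorem PlaneShift.smul_eq (X : SimpleGraph W) {N : ℕ} (g : PlaneShift W N) (x : W × Site 2) :
    g • x = prodShiftIso X (Pi.single 0 ((N : ℤ) * g.exp)) x := rfl

/-- The action is by automorphisms of `X □ ℤ²`. [folklore] -/
theorem planeShift_isActionByAut (X : SimpleGraph W) (N : ℕ) : IsActionByAut (X □ zdGraph 2) (PlaneShift W N) :=
  fun g x y => by rw [PlaneShift.smul_eq X, PlaneShift.smul_eq X]; exact (prodShiftIso X _).map_rel_iff'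

/-- The action is free (`N ≠ 0`). [folklore] -/
theorem planeShift_free {N : ℕ} (hN : N ≠ 0) (g : PlaneShift W N) (x : W × Site 2) (h : g • x = x) : g = 1 := by
  have h2 := congrFun (congrArg Prod.snd h) 0
  rw [PlaneShift.smul_def] at h2
  simp only [Pi.add_apply, Pi.single_eq_same, add_eq_left] at h2
  rcases mul_eq_zero.1 h2 with h' | h'
  · exact absurd (by exact_mod_cast h') hN
  · exact PlaneShift.exp_injective (by simpa using h')

/-- Product automorphisms commute with the action. [folklore] -/
theorem boxProdIso_smul (X : SimpleGraph W) {N : ℕ} (g : PlaneShift W N) (γ : X ≃g X) (v : Site 2)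
    (x : W × Site 2) : boxProdIso γ (zdShiftIso v) (g • x) = g • boxProdIso γ (zdShiftIso v) x := by
  rw [PlaneShift.smul_def, PlaneShift.smul_def, boxProdIso_apply, boxProdIso_apply]
  refine Prod.ext rfl ?_
  show x.2 + Pi.single 0 (↑N * g.exp) + v = x.2 + v + Pi.single 0 (↑N * g.exp)
  abel

/-- The quotient `Γ_N \ (X □ ℤ²)` is quasi-transitive when `X` is. [folklore] -/
theorem quot_quasiTransitive {X : SimpleGraph W} (hX : IsQuasiTransitive X) (N : ℕ) :
    IsQuasiTransitive (orbitQuotientGraph (X □ zdGraph 2) (PlaneShift W N)) := by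
  classical
  obtain ⟨V₀, hV⟩ := hX
  refine ⟨V₀.image fun w => qmk (PlaneShift W N) ((w, (0 : Site 2)) : W × Site 2), fun u => ?_⟩
  induction u using Quotient.inductionOn' with
  | h v =>
  obtain ⟨γ, hγ⟩ := hV v.1
  refine ⟨HeisenbergZ.quotIsoOfEquivariant (planeShift_isActionByAut X N) (boxProdIso γ (zdShiftIso (-v.2)))
    (fun g x => boxProdIso_smul X g γ (-v.2) x), ?_⟩
  rw [Finset.mem_image]
  refine ⟨γ v.1, hγ, ?_⟩
  show qmk (PlaneShift W N) (γ v.1, 0) = qmk (PlaneShift W N) (boxProdIso γ (zdShiftIso (-v.2)) v)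
  rw [boxProdIso_apply, zdShiftIso_apply, add_neg_cancel]

/-! ## The tube meets each orbit once and has no edge to its translates (`N > 2ℓ + 1`) -/

/-- (i) `x, g•x ∈ tube ℓ ⇒ g = 1` once `N > 2ℓ`. [folklore] -/
theorem tube_orbit_once {N ℓ : ℕ} (hN : 2 * ℓ < N) (g : PlaneShift W N) (x : W × Site 2)
    (hx : x ∈ tube W ℓ) (hgx : g • x ∈ tube W ℓ) : g = 1 := by
  have h1 := (mem_box.1 ((mem_tube ℓ _).1 hx)) 0
  have h2' := (mem_tube ℓ _).1 hgx
  rw [PlaneShift.smul_def] at h2'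
  have h2 := (mem_box.1 h2') 0
  simp only [Pi.add_apply, Pi.single_eq_same] at h2
  have hb : |(N : ℤ) * g.exp| ≤ (2 * ℓ : ℕ) := by
    rw [abs_le]; push_cast; constructor <;> linarith [h1.1, h1.2, h2.1, h2.2]
  exact PlaneShift.exp_injective (by simpa using HeisenbergZ2.exp_eq_zero_of_abs_mul_le hN hb)

/-- (ii) no edge from the tube to a non-trivial translate once `N > 2ℓ + 1`. [folklore] -/
theorem tube_no_edge (X : SimpleGraph W) {N ℓ : ℕ} (hN : 2 * ℓ + 1 < N) (g : PlaneShift W N)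
    (x y : W × Site 2) (hx : x ∈ tube W ℓ) (hy : y ∈ tube W ℓ) (h : (X □ zdGraph 2).Adj x (g • y)) : g = 1 := by
  have h1 := (mem_box.1 ((mem_tube ℓ _).1 hx)) 0
  have h2 := (mem_box.1 ((mem_tube ℓ _).1 hy)) 0
  rw [SimpleGraph.boxProd_adj, PlaneShift.smul_def] at h
  have hb : |(N : ℤ) * g.exp| ≤ (2 * ℓ + 1 : ℕ) := by
    rcases h with ⟨-, hu⟩ | ⟨hu, -⟩
    · have hu0 := congrFun hu 0
      simp only [Pi.add_apply, Pi.single_eq_same] at hu0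
      rw [abs_le]; push_cast; constructor <;> linarith [h1.1, h1.2, h2.1, h2.2]
    · have h3 := Literature.Probability.RandomPlanarGeometry.PlaneNonIntersection.abs_sub_le_one_of_adj hu 0
      simp only [Pi.add_apply, Pi.single_eq_same] at h3
      rw [abs_le] at h3 ⊢; push_cast; constructor <;> linarith [h1.1, h1.2, h2.1, h2.2, h3.1, h3.2]
  exact PlaneShift.exp_injective (by simpa using HeisenbergZ2.exp_eq_zero_of_abs_mul_le hN hb)

/-! ## Tubes are strictly subcritical at `p_c` -/

/-- **`p_c(X □ ℤ², (w,0)) < p_c((X □ ℤ²)[X × [−ℓ,ℓ]²], (w,0))`** for every `ℓ` and `w`, `X` connected,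
locally finite, quasi-transitive (Martineau–Severo through `Γ_{2ℓ+2}`). [cite: MartineauSevero2019, Cor. 2.2] -/
theorem criticalProb_lt_criticalProb_tube [Countable W] [DecidableEq W] (X : SimpleGraph W) [X.LocallyFinite]
    (hc : X.Connected) (hq : IsQuasiTransitive X) (ℓ : ℕ) (w : W) :
    criticalProb (X □ zdGraph 2) (w, 0) <
      criticalProb ((X □ zdGraph 2).induce (tube W ℓ)) ⟨(w, 0), mem_tube_zero w ℓ⟩ := by
  have hN : (2 * ℓ + 2) ≠ 0 := by omega
  exact QuotientSlab.criticalProb_lt_criticalProb_induce_of_quotient (Γ := PlaneShift W (2 * ℓ + 2))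
    (X □ zdGraph 2) (planeShift_isActionByAut X _) (planeShift_free hN) (connected_boxProd_zdGraph hc 2)
    (isQuasiTransitive_boxProd_zdGraph hq 2) (quot_quasiTransitive hq _) (tube_orbit_once (by omega))
    (tube_no_edge X (by omega)) (w, 0) (mem_tube_zero w ℓ) (criticalProb_boxProdZ2_lt_one X w)

/-- **No tube percolates at `p_c(X □ ℤ²)`** — the hypothesis `TubeSubcritical X p_c` of `SamePWitnessBoxProdZ2`,
DISCHARGED for every connected locally finite quasi-transitive `X` on a countable vertex type (the amenability and
infinitude hypotheses of the flagship are accepted but not needed).  The critical point may be taken at any base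
vertex `(w,0)` (`X □ ℤ²` is connected). [cite: MartineauSevero2019, Cor. 2.2] -/
theorem tubeSubcritical_criticalProb [Countable W] [DecidableEq W] (X : SimpleGraph W) [X.LocallyFinite]
    (hc : X.Connected) (hq : IsQuasiTransitive X) (_ha : IsGraphAmenable X) (_hinf : Infinite W) (w : W) :
    TubeSubcritical X ⟨criticalProb (X □ zdGraph 2) (w, 0), criticalProb_mem_Icc _ _⟩ := by
  intro ℓ w'
  have hpc : criticalProb (X □ zdGraph 2) (w, 0) = criticalProb (X □ zdGraph 2) (w', 0) :=
    criticalProb_eq_of_reachable _ ((connected_boxProd_zdGraph hc 2).preconnected (w, 0) (w', 0))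
  have hlt := criticalProb_lt_criticalProb_tube X hc hq ℓ w'
  refine theta_eq_zero_of_lt_criticalProb_holds _ _ _ ?_
  show criticalProb (X □ zdGraph 2) (w, 0) < _
  rw [hpc]; exact hlt

/-- The same without the unused hypotheses. [cite: MartineauSevero2019, Cor. 2.2] -/
theorem tubeSubcritical_criticalProb' [Countable W] [DecidableEq W] (X : SimpleGraph W) [X.LocallyFinite]
    (hc : X.Connected) (hq : IsQuasiTransitive X) (w : W) :
    TubeSubcritical X ⟨criticalProb (X □ zdGraph 2) (w, 0), criticalProb_mem_Icc _ _⟩ := by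
  intro ℓ w'
  have hpc : criticalProb (X □ zdGraph 2) (w, 0) = criticalProb (X □ zdGraph 2) (w', 0) :=
    criticalProb_eq_of_reachable _ ((connected_boxProd_zdGraph hc 2).preconnected (w, 0) (w', 0))
  have hlt := criticalProb_lt_criticalProb_tube X hc hq ℓ w'
  refine theta_eq_zero_of_lt_criticalProb_holds _ _ _ ?_
  show criticalProb (X □ zdGraph 2) (w, 0) < _
  rw [hpc]; exact hlt

end Summit.CriticalPhenomena.PercolationContinuityZ3.Theorems.Transplant.BoxProdZ2
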